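import Mathlib
import Summits.Ventures.PercRepro2.IteratedBK

/-! # Parallel splitting for the connection event (seat mine-b, cell pub-perc-repro2)
Two edge sets `E₁`, `E₂` that share only the terminals `s`, `t` (`SharesOnlyPair`): every carrying
set `K ⊆ E₁ ∪ E₂` for `s–t` carries `s–t` inside `E₁` or inside `E₂` (`carries_parallel_split`: a
path from `s` to `t` has no interior vertex in `{s, t}`, so it cannot change side), and `k`
disjoint witnesses split into `k₁` inside `E₁` and `k₂` inside `E₂` with `k₁ + k₂ = k`
(`kDisj_parallel_split`) and merge back (`kDisj_parallel_merge`) — the combinatorial content of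
`F = F₁ + F₂` for a parallel composition, the companion of `SeriesSplit.lean` (`F = min(F₁, F₂)`).
Together they are the product-family dictionary behind `FlowSumClosure.lean` / `V2SP.lean`. -/

open Finset
namespace Summit.Ventures.PercRepro2

section ParallelSplit

variable {V : Type*} {E : Type*} [DecidableEq V] [DecidableEq E]

/-- the parts share only the terminals: a vertex incident to edges of both parts is `s` or `t` -/
def SharesOnlyPair (ends : E → Sym2 V) (s t : V) (E₁ E₂ : Finset E) : Prop :=
  ∀ e₁ ∈ E₁, ∀ e₂ ∈ E₂, ∀ x, x ∈ ends e₁ → x ∈ ends e₂ → x = s ∨ x = t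

omit [DecidableEq V] [DecidableEq E] in
/-- symmetric in the parts -/
lemma SharesOnlyPair.symm {ends : E → Sym2 V} {s t : V} {E₁ E₂ : Finset E}
    (h : SharesOnlyPair ends s t E₁ E₂) : SharesOnlyPair ends s t E₂ E₁ :=
  fun e₂ h₂ e₁ h₁ x hx₂ hx₁ => h e₁ h₁ e₂ h₂ x hx₁ hx₂

omit [DecidableEq V] in
/-- along a path of `K`-edges ending at `t` that avoids `s`, a vertex touched by a `K ∩ E₁`-edge is
`K ∩ E₁`-connected to `t`: the path cannot change side, since a side change happens at a vertex
of both parts, i.e. at `s` or `t`, and neither is an interior vertex of the path -/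
lemma conn_side_of_path {ends : E → Sym2 V} {s t : V} {E₁ E₂ : Finset E}
    (hE : SharesOnlyPair ends s t E₁ E₂) {K : Finset E} (hK : K ⊆ E₁ ∪ E₂) :
    ∀ {u x : V} (w : (openGraph ends (ofFinset K)).Walk u x), x = t → w.IsPath → s ∉ w.support →
      (u = x ∨ ∃ e ∈ K ∩ E₁, u ∈ ends e) → Conn ends (ofFinset (K ∩ E₁)) u x := by
  intro u x w
  induction w with
  | nil =>
    intro _ _ _ _
    exact conn_refl _ _ _
  | @cons u u' x hadj w' ih =>
    intro hxt hp hs hu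
    have hp' : w'.IsPath := hp.of_cons
    have hnodup := hp.support_nodup
    rw [SimpleGraph.Walk.support_cons, List.nodup_cons] at hnodup
    have hux : u ≠ x := by
      intro h; subst h; exact hnodup.1 (SimpleGraph.Walk.end_mem_support w')
    have hus : u ≠ s := by
      intro h; subst h
      exact hs (SimpleGraph.Walk.start_mem_support _)
    have hs' : s ∉ w'.support := fun h => hs (by rw [SimpleGraph.Walk.support_cons]; exact List.mem_cons_of_mem _ h)
    rcases hu with hu | ⟨e, he, hue⟩
    · exact absurd hu hux
    · rw [openGraph_adj] at hadj
      obtain ⟨_, e', he'open, he'ends⟩ := hadj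
      have he'K : e' ∈ K := ofFinset_eq_true_iff.1 he'open
      have hu' : u ∈ ends e' := by rw [he'ends]; exact Sym2.mem_mk_left u u'
      have he'E₁ : e' ∈ E₁ := by
        rcases Finset.mem_union.1 (hK he'K) with h1 | h1
        · exact h1
        · rcases hE e (Finset.mem_of_mem_inter_right he) e' h1 u hue hu' with h | h
          · exact absurd h hus
          · rw [hxt] at hux; exact absurd h hux
      have hadj' : OpenAdj ends (ofFinset (K ∩ E₁)) u u' :=
        ⟨e', ofFinset_eq_true_iff.2 (Finset.mem_inter.2 ⟨he'K, he'E₁⟩), he'ends⟩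
      have hu'e : u' ∈ ends e' := by rw [he'ends]; exact Sym2.mem_mk_right u u'
      have hrest := ih hxt hp' hs' (Or.inr ⟨e', Finset.mem_inter.2 ⟨he'K, he'E₁⟩, hu'e⟩)
      exact conn_trans (conn_of_openAdj hadj') hrest

/-- **a carrying set carries on one side**: if `K ⊆ E₁ ∪ E₂` carries `s` to `t` and the parts share
only `s`, `t`, then `K ∩ E₁` or `K ∩ E₂` carries `s` to `t` -/
lemma carries_parallel_split {ends : E → Sym2 V} {s t : V} {E₁ E₂ : Finset E}
    (hE : SharesOnlyPair ends s t E₁ E₂) (hst : s ≠ t) {K : Finset E} (hK : K ⊆ E₁ ∪ E₂)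
    (hc : Carries ends K s t) : Carries ends (K ∩ E₁) s t ∨ Carries ends (K ∩ E₂) s t := by
  obtain ⟨w₀⟩ := hc
  -- pass to a path
  obtain ⟨w, hp⟩ := w₀.toPath
  cases w with
  | nil => exact absurd rfl hst
  | @cons _ u _ hadj w' =>
    have hp' : w'.IsPath := hp.of_cons
    have hnodup := hp.support_nodup
    rw [SimpleGraph.Walk.support_cons, List.nodup_cons] at hnodup
    have hs' : s ∉ w'.support := hnodup.1
    rw [openGraph_adj] at hadj
    obtain ⟨_, e, heopen, heends⟩ := hadj
    have heK : e ∈ K := ofFinset_eq_true_iff.1 heopen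
    have hue : u ∈ ends e := by rw [heends]; exact Sym2.mem_mk_right s u
    rcases Finset.mem_union.1 (hK heK) with h1 | h1
    · left
      have hadj' : OpenAdj ends (ofFinset (K ∩ E₁)) s u :=
        ⟨e, ofFinset_eq_true_iff.2 (Finset.mem_inter.2 ⟨heK, h1⟩), heends⟩
      have hrest := conn_side_of_path hE hK w' rfl hp' hs' (Or.inr ⟨e, Finset.mem_inter.2 ⟨heK, h1⟩, hue⟩)
      exact conn_trans (conn_of_openAdj hadj') hrest
    · right
      have hK' : K ⊆ E₂ ∪ E₁ := by rw [Finset.union_comm]; exact hK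
      have hadj' : OpenAdj ends (ofFinset (K ∩ E₂)) s u :=
        ⟨e, ofFinset_eq_true_iff.2 (Finset.mem_inter.2 ⟨heK, h1⟩), heends⟩
      have hrest := conn_side_of_path hE.symm hK' w' rfl hp' hs' (Or.inr ⟨e, Finset.mem_inter.2 ⟨heK, h1⟩, hue⟩)
      exact conn_trans (conn_of_openAdj hadj') hrest

/-- **parallel splitting of `k` disjoint witnesses**: `k₁` of them live inside `E₁`, `k₂` inside
`E₂`, `k₁ + k₂ = k` -/
lemma kDisj_parallel_split {ends : E → Sym2 V} {s t : V} {E₁ E₂ : Finset E}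
    (hE : SharesOnlyPair ends s t E₁ E₂) (hst : s ≠ t) :
    ∀ (k : ℕ) {S : Finset E}, S ⊆ E₁ ∪ E₂ → kDisj (fun S => Carries ends S s t) k S →
      ∃ k₁ k₂, k₁ + k₂ = k ∧ kDisj (fun S => Carries ends S s t) k₁ (S ∩ E₁)
        ∧ kDisj (fun S => Carries ends S s t) k₂ (S ∩ E₂)
  | 0, _, _, _ => ⟨0, 0, rfl, trivial, trivial⟩
  | k + 1, S, hS, h => by
      obtain ⟨K, L, hK, hL, hKL, hA, hB⟩ := h
      obtain ⟨k₁, k₂, hk, h₁, h₂⟩ := kDisj_parallel_split hE hst k (hL.trans hS) (hB L le_rfl)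
      have hd : ∀ X : Finset E, Disjoint (K ∩ X) (L ∩ X) := fun X =>
        Finset.disjoint_of_subset_left Finset.inter_subset_left
          (Finset.disjoint_of_subset_right Finset.inter_subset_left hKL)
      have h₁' : kDisj (fun S => Carries ends S s t) k₁ (S ∩ E₁) :=
        incr_kDisj _ k₁ (Finset.inter_subset_inter hL le_rfl) h₁
      have h₂' : kDisj (fun S => Carries ends S s t) k₂ (S ∩ E₂) :=
        incr_kDisj _ k₂ (Finset.inter_subset_inter hL le_rfl) h₂
      rcases carries_parallel_split hE hst (hK.trans hS) (hA K le_rfl) with hc | hc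
      · refine ⟨k₁ + 1, k₂, by omega, ?_, h₂'⟩
        exact ⟨K ∩ E₁, L ∩ E₁, Finset.inter_subset_inter hK le_rfl, Finset.inter_subset_inter hL le_rfl,
          hd E₁, fun T hT => Carries.mono hT hc, fun T hT => incr_kDisj _ k₁ hT h₁⟩
      · refine ⟨k₁, k₂ + 1, by omega, h₁', ?_⟩
        exact ⟨K ∩ E₂, L ∩ E₂, Finset.inter_subset_inter hK le_rfl, Finset.inter_subset_inter hL le_rfl,
          hd E₂, fun T hT => Carries.mono hT hc, fun T hT => incr_kDisj _ k₂ hT h₂⟩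

omit [DecidableEq V] in
/-- **parallel merging of witnesses**: `k₁` disjoint witnesses in `S₁` and `k₂` in `S₂` (disjoint
sets) give `k₁ + k₂` in `S₁ ∪ S₂` -/
lemma kDisj_parallel_merge {ends : E → Sym2 V} {s t : V} :
    ∀ (k₁ : ℕ) {k₂ : ℕ} {S₁ S₂ : Finset E}, Disjoint S₁ S₂ →
      kDisj (fun S => Carries ends S s t) k₁ S₁ → kDisj (fun S => Carries ends S s t) k₂ S₂ →
      kDisj (fun S => Carries ends S s t) (k₁ + k₂) (S₁ ∪ S₂)
  | 0, k₂, S₁, S₂, _, _, h₂ => by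
      rw [zero_add]
      exact incr_kDisj _ k₂ Finset.subset_union_right h₂
  | k₁ + 1, k₂, S₁, S₂, hd, h₁, h₂ => by
      obtain ⟨K, L, hK, hL, hKL, hA, hB⟩ := h₁
      have hrest := kDisj_parallel_merge k₁ (Finset.disjoint_of_subset_left hL hd) (hB L le_rfl) h₂
      rw [show k₁ + 1 + k₂ = (k₁ + k₂) + 1 by omega]
      refine ⟨K, L ∪ S₂, hK.trans Finset.subset_union_left, Finset.union_subset_union hL le_rfl, ?_,
        fun T hT => Carries.mono hT (hA K le_rfl), fun T hT => incr_kDisj _ (k₁ + k₂) hT hrest⟩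
      rw [Finset.disjoint_union_right]
      exact ⟨hKL, Finset.disjoint_of_subset_left hK hd⟩

end ParallelSplit

end Summit.Ventures.PercRepro2
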